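import Mathlib.Analysis.SpecialFunctions.Integrals.Basic
import Mathlib.Analysis.SpecialFunctions.ImproperIntegrals
import Mathlib.MeasureTheory.Integral.Bochner.Set
import Mathlib.MeasureTheory.Measure.Lebesgue.Integral
import Mathlib.Topology.Algebra.Support
import HarnessLib

/-!
# Decay of the truncated Hilbert transform of a localized function with mean zero

Topic `Literature/Analysis/Fourier`. For a function `g : ℝ → ℝ` we consider the truncated
(principal-value) Hilbert integral, written out as

  `𝒯g(x) = ∫_{(-1,1)} (g(x-u) - g(x))/u du + ∫_{|u| ≥ 1} g(x-u)/u du`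

(this is `π` times the Hilbert transform of `g`, in the absolutely convergent form valid for
Lipschitz `g`; it is the derivative kernel of the modified Hilbert transform used in
`SchwarzIntegral.lean`). We prove:

* `hilbertPV_split_eq` — the split point `1` may be replaced by any `r > 0`
  (`∫_{s ≤ |u| < t} du/u = 0`);
* `abs_hilbertPV_le_of_localized` — **scale-invariant decay**: if `g` is continuous, supported in
  `[a-ρ, a+ρ]`, `|g| ≤ M₁`, `(M₂/ρ)`-Lipschitz and `∫ g = 0`, then
  `|𝒯g(x)| ≤ 10 (M₁ + M₂) / (1 + ((x-a)/ρ)²)`;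
* `hilbertPV_finset_sum` — additivity over finite sums of Lipschitz compactly supported functions;
* `sum_inv_one_add_sq_le_of_separated` — `∑ᵢ 1/(1+pᵢ²) ≤ 2π` for `1`-separated reals `pᵢ`.

These are the estimates (e:hilbert-deriative-bound), (e:bound-chi-tilde), (e:bound-mnclose) of
Jin–Zhang, arXiv:1710.00250, §§2.3, 4.1, in elementary form. All statements are folklore;
no definitions are introduced.
-/

namespace Literature.Analysis.Fourier

open _root_.MeasureTheory Set Filter Metric
open scoped Real Topology

/-! ### Sets and elementary integrals -/

section Sets

/-- The annulus `{s ≤ |u| < t}`. [folklore] -/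
theorem measurableSet_annulus (s t : ℝ) : MeasurableSet {u : ℝ | s ≤ |u| ∧ |u| < t} :=
  (measurableSet_le measurable_const continuous_abs.measurable).inter
    (measurableSet_lt continuous_abs.measurable measurable_const)

/-- `{u | r ≤ |u|}` is measurable. [folklore] -/
theorem measurableSet_le_abs (r : ℝ) : MeasurableSet {u : ℝ | r ≤ |u|} :=
  measurableSet_le measurable_const continuous_abs.measurable

/-- `{u | |u| < r} = (-r, r)`. [folklore] -/
theorem setOf_abs_lt_eq_Ioo (r : ℝ) : {u : ℝ | |u| < r} = Ioo (-r) r := by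
  ext u; simp [abs_lt, mem_Ioo]

/-- The annulus has finite measure. [folklore] -/
theorem volume_annulus_lt_top (s t : ℝ) : volume {u : ℝ | s ≤ |u| ∧ |u| < t} < ⊤ := by
  refine (measure_mono (fun u hu => ?_)).trans_lt (measure_Ioo_lt_top (a := -t) (b := t))
  exact mem_Ioo.2 (abs_lt.1 hu.2)

/-- `∫_{s ≤ |u| < t} du/u = 0` for `0 < s` (the two halves cancel). [folklore] -/
theorem setIntegral_annulus_inv_eq_zero {s t : ℝ} (hs : 0 < s) :
    ∫ u in {u : ℝ | s ≤ |u| ∧ |u| < t}, u⁻¹ = 0 := by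
  rcases le_or_gt t s with hts | hst
  · have : {u : ℝ | s ≤ |u| ∧ |u| < t} = ∅ := by
      ext u; simp only [mem_setOf_eq, mem_empty_iff_false, iff_false, not_and, not_lt]
      intro h; linarith
    rw [this, Measure.restrict_empty, integral_zero_measure]
  -- split into the positive and negative halves
  have hset : {u : ℝ | s ≤ |u| ∧ |u| < t} = Ico s t ∪ Ioc (-t) (-s) := by
    ext u
    simp only [mem_setOf_eq, mem_union, mem_Ico, mem_Ioc]
    constructor
    · rintro ⟨h1, h2⟩
      rcases le_or_gt 0 u with hu | hu
      · rw [abs_of_nonneg hu] at h1 h2; exact Or.inl ⟨h1, h2⟩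
      · rw [abs_of_neg hu] at h1 h2; exact Or.inr ⟨by linarith, by linarith⟩
    · rintro (⟨h1, h2⟩ | ⟨h1, h2⟩)
      · have hu : 0 < u := hs.trans_le h1
        rw [abs_of_pos hu]; exact ⟨h1, h2⟩
      · have hu : u < 0 := by linarith
        rw [abs_of_neg hu]; exact ⟨by linarith, by linarith⟩
  have hdisj : Disjoint (Ico s t) (Ioc (-t) (-s)) := by
    rw [Set.disjoint_left]
    rintro u ⟨h1, -⟩ ⟨-, h2⟩
    linarith
  have hint1 : IntegrableOn (fun u : ℝ => u⁻¹) (Ico s t) := by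
    refine ((continuousOn_inv₀.mono ?_).integrableOn_compact isCompact_Icc).mono_set Ico_subset_Icc_self
    intro u hu; simp only [mem_compl_iff, mem_singleton_iff]; exact (hs.trans_le hu.1).ne'
  have hint2 : IntegrableOn (fun u : ℝ => u⁻¹) (Ioc (-t) (-s)) := by
    refine ((continuousOn_inv₀.mono ?_).integrableOn_compact isCompact_Icc).mono_set Ioc_subset_Icc_self
    intro u hu; simp only [mem_compl_iff, mem_singleton_iff]
    have : u < 0 := by linarith [hu.2]
    exact this.ne
  rw [hset, setIntegral_union hdisj measurableSet_Ioc hint1 hint2]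
  have h1 : ∫ u in Ico s t, u⁻¹ = Real.log (t / s) := by
    rw [integral_Ico_eq_integral_Ioc, ← intervalIntegral.integral_of_le hst.le,
      integral_inv_of_pos hs (hs.trans hst)]
  have h2 : ∫ u in Ioc (-t) (-s), u⁻¹ = -Real.log (t / s) := by
    rw [← intervalIntegral.integral_of_le (by linarith), integral_inv_of_neg (by linarith) (by linarith)]
    rw [show -s / -t = s / t by rw [neg_div_neg_eq], ← Real.log_inv, inv_div]
  rw [h1, h2]
  ring

end Sets

/-! ### Integrability of the pieces for Lipschitz, boundedly supported `g` -/

section Pieces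

variable {g : ℝ → ℝ} {a ρ M₁ M₂ : ℝ}

/-- The near integrand `(g(x-u) - g(x))/u` is bounded by the Lipschitz constant. [folklore] -/
theorem abs_near_integrand_le (hLip : ∀ u v, |g u - g v| ≤ M₂ / ρ * |u - v|) (hρ : 0 < ρ)
    (hM₂ : 0 ≤ M₂) (x u : ℝ) : |(g (x - u) - g x) / u| ≤ M₂ / ρ := by
  by_cases hu : u = 0
  · simp [hu]; positivity
  · rw [abs_div, div_le_iff₀ (abs_pos.2 hu)]
    have := hLip (x - u) x
    rwa [show x - u - x = -u by ring, abs_neg] at this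

/-- The near piece is integrable on any bounded symmetric interval. [folklore] -/
theorem integrableOn_near_Ioo (hg : Continuous g) (hLip : ∀ u v, |g u - g v| ≤ M₂ / ρ * |u - v|)
    (hρ : 0 < ρ) (hM₂ : 0 ≤ M₂) (x r : ℝ) :
    IntegrableOn (fun u => (g (x - u) - g x) / u) (Ioo (-r) r) := by
  refine Measure.integrableOn_of_bounded (M := M₂ / ρ) measure_Ioo_lt_top.ne
    ((((hg.comp (continuous_sub_left x)).sub continuous_const).measurable.div
      measurable_id).aestronglyMeasurable) ?_
  exact (ae_restrict_iff' measurableSet_Ioo).2 (ae_of_all _ fun u _ => by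
    rw [Real.norm_eq_abs]; exact abs_near_integrand_le hLip hρ hM₂ x u)

/-- The far integrand `g(x-u)/u` on `{r ≤ |u|}` is bounded by `M₁/r` and vanishes unless
`|x - u - a| ≤ ρ`. [folklore] -/
theorem integrableOn_far (hg : Continuous g) (hsupp : ∀ u, ρ < |u - a| → g u = 0)
    (hM₁ : ∀ u, |g u| ≤ M₁) {r : ℝ} (hr : 0 < r) (x : ℝ) :
    IntegrableOn (fun u => g (x - u) / u) {u : ℝ | r ≤ |u|} := by
  have hM₁0 : 0 ≤ M₁ := (abs_nonneg _).trans (hM₁ 0)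
  have hmeas : AEStronglyMeasurable (fun u => g (x - u) / u) volume :=
    ((hg.comp (continuous_sub_left x)).measurable.div measurable_id).aestronglyMeasurable
  -- integrable on the bounded part, zero elsewhere
  have hint : IntegrableOn (fun u => g (x - u) / u) (closedBall (x - a) ρ ∩ {u : ℝ | r ≤ |u|}) := by
    refine Measure.integrableOn_of_bounded (M := M₁ / r) ?_ hmeas ?_
    · exact ((measure_mono inter_subset_left).trans_lt measure_closedBall_lt_top).ne
    · refine (ae_restrict_iff' (measurableSet_closedBall.inter (measurableSet_le_abs r))).2
        (ae_of_all _ fun u hu => ?_)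
      have hu1 : r ≤ |u| := hu.2
      rw [Real.norm_eq_abs, abs_div]
      exact div_le_div₀ hM₁0 (hM₁ _) hr hu1
  have hzero : ∀ u, u ∉ closedBall (x - a) ρ → g (x - u) / u = 0 := by
    intro u hu
    rw [mem_closedBall, Real.dist_eq, not_le] at hu
    rw [hsupp (x - u) (by rw [show x - u - a = -(u - (x - a)) by ring, abs_neg]; exact hu), zero_div]
  have hsplit : {u : ℝ | r ≤ |u|} =
      (closedBall (x - a) ρ ∩ {u : ℝ | r ≤ |u|}) ∪ ((closedBall (x - a) ρ)ᶜ ∩ {u : ℝ | r ≤ |u|}) := by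
    rw [← union_inter_distrib_right, union_compl_self, univ_inter]
  rw [hsplit]
  refine hint.union ?_
  exact integrableOn_zero.congr_fun (fun u hu => (hzero u hu.1).symm)
    (measurableSet_closedBall.compl.inter (measurableSet_le_abs r))

end Pieces

/-! ### Independence of the split point -/

section Split

variable {g : ℝ → ℝ} {a ρ M₁ M₂ : ℝ}

/-- Moving the split point outwards: for `0 < s ≤ t`,
`∫_{(-s,s)} N + ∫_{s≤|u|} F = ∫_{(-t,t)} N + ∫_{t≤|u|} F`, where `N(u) = (g(x-u)-g(x))/u`,
`F(u) = g(x-u)/u`. [folklore] -/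
theorem hilbertPV_split_mono (hg : Continuous g) (hLip : ∀ u v, |g u - g v| ≤ M₂ / ρ * |u - v|)
    (hρ : 0 < ρ) (hM₂ : 0 ≤ M₂) (hsupp : ∀ u, ρ < |u - a| → g u = 0) (hM₁ : ∀ u, |g u| ≤ M₁)
    {s t : ℝ} (hs : 0 < s) (hst : s ≤ t) (x : ℝ) :
    (∫ u in Ioo (-s) s, (g (x - u) - g x) / u) + ∫ u in {u : ℝ | s ≤ |u|}, g (x - u) / u =
      (∫ u in Ioo (-t) t, (g (x - u) - g x) / u) + ∫ u in {u : ℝ | t ≤ |u|}, g (x - u) / u := by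
  set A : Set ℝ := {u : ℝ | s ≤ |u| ∧ |u| < t} with hA
  have hAm : MeasurableSet A := measurableSet_annulus s t
  have hset1 : Ioo (-t) t = Ioo (-s) s ∪ A := by
    ext u
    simp only [mem_Ioo, mem_union, hA, mem_setOf_eq, ← abs_lt]
    constructor
    · intro h
      rcases lt_or_ge |u| s with h' | h'
      · exact Or.inl h'
      · exact Or.inr ⟨h', h⟩
    · rintro (h | ⟨-, h⟩)
      · exact h.trans_le hst
      · exact h
  have hdisj1 : Disjoint (Ioo (-s) s) A := by
    rw [Set.disjoint_left]
    intro u hu huA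
    rw [mem_Ioo, ← abs_lt] at hu
    exact absurd huA.1 (not_le.2 hu)
  have hset2 : {u : ℝ | s ≤ |u|} = A ∪ {u : ℝ | t ≤ |u|} := by
    ext u
    simp only [mem_setOf_eq, mem_union, hA]
    constructor
    · intro h
      rcases lt_or_ge |u| t with h' | h'
      · exact Or.inl ⟨h, h'⟩
      · exact Or.inr h'
    · rintro (⟨h, -⟩ | h)
      · exact h
      · exact hst.trans h
  have hdisj2 : Disjoint A {u : ℝ | t ≤ |u|} := by
    rw [Set.disjoint_left]
    intro u huA hu
    exact absurd huA.2 (not_lt.2 hu)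
  -- integrability of the pieces
  have hN : IntegrableOn (fun u => (g (x - u) - g x) / u) (Ioo (-t) t) :=
    integrableOn_near_Ioo hg hLip hρ hM₂ x t
  have hNs : IntegrableOn (fun u => (g (x - u) - g x) / u) (Ioo (-s) s) :=
    hN.mono_set (Ioo_subset_Ioo (by linarith) hst)
  have hNA : IntegrableOn (fun u => (g (x - u) - g x) / u) A := hN.mono_set (hset1 ▸ subset_union_right)
  have hF : IntegrableOn (fun u => g (x - u) / u) {u : ℝ | s ≤ |u|} := integrableOn_far hg hsupp hM₁ hs x
  have hFA : IntegrableOn (fun u => g (x - u) / u) A := hF.mono_set (hset2 ▸ subset_union_left)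
  have hFt : IntegrableOn (fun u => g (x - u) / u) {u : ℝ | t ≤ |u|} :=
    hF.mono_set (hset2 ▸ subset_union_right)
  -- on the annulus the two integrands differ by `g x · u⁻¹`, which integrates to zero
  have hinvA : IntegrableOn (fun u : ℝ => u⁻¹) A := by
    refine Measure.integrableOn_of_bounded (M := s⁻¹) (volume_annulus_lt_top s t).ne
      measurable_inv.aestronglyMeasurable ?_
    refine (ae_restrict_iff' hAm).2 (ae_of_all _ fun u hu => ?_)
    rw [norm_inv, Real.norm_eq_abs]
    exact inv_anti₀ hs hu.1
  have hkey : ∫ u in A, (g (x - u) - g x) / u = ∫ u in A, g (x - u) / u := by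
    have h1 : ∫ u in A, (g (x - u) - g x) / u = ∫ u in A, (g (x - u) / u - g x * u⁻¹) :=
      integral_congr_ae (ae_of_all _ fun u => by ring)
    rw [h1, integral_sub hFA (hinvA.const_mul _), integral_const_mul,
      setIntegral_annulus_inv_eq_zero hs, mul_zero, sub_zero]
  rw [hset1, hset2, setIntegral_union hdisj1 hAm hNs hNA, setIntegral_union hdisj2 (measurableSet_le_abs t)
    hFA hFt, hkey]
  ring

/-- **The split point of the truncated Hilbert integral is arbitrary**: for every `r > 0`,
`∫_{(-1,1)} (g(x-u)-g(x))/u + ∫_{|u|≥1} g(x-u)/u = ∫_{(-r,r)} (g(x-u)-g(x))/u + ∫_{|u|≥r} g(x-u)/u`.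
[folklore] -/
theorem hilbertPV_split_eq (hg : Continuous g) (hLip : ∀ u v, |g u - g v| ≤ M₂ / ρ * |u - v|)
    (hρ : 0 < ρ) (hM₂ : 0 ≤ M₂) (hsupp : ∀ u, ρ < |u - a| → g u = 0) (hM₁ : ∀ u, |g u| ≤ M₁)
    {r : ℝ} (hr : 0 < r) (x : ℝ) :
    (∫ u in Ioo (-1 : ℝ) 1, (g (x - u) - g x) / u) + ∫ u in {u : ℝ | 1 ≤ |u|}, g (x - u) / u =
      (∫ u in Ioo (-r) r, (g (x - u) - g x) / u) + ∫ u in {u : ℝ | r ≤ |u|}, g (x - u) / u := by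
  rcases le_or_gt r 1 with h | h
  · exact (hilbertPV_split_mono hg hLip hρ hM₂ hsupp hM₁ hr h x).symm
  · have := hilbertPV_split_mono hg hLip hρ hM₂ hsupp hM₁ one_pos h.le x
    simpa using this

end Split

/-! ### Scale-invariant decay -/

section Decay

variable {g : ℝ → ℝ} {a ρ M₁ M₂ : ℝ}

/-- `∫ |g(x - u)| du ≤ 2 ρ M₁` for `g` supported in `[a-ρ, a+ρ]` with `|g| ≤ M₁`. [folklore] -/
theorem integral_abs_comp_sub_le (hg : Continuous g) (hsupp : ∀ u, ρ < |u - a| → g u = 0)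
    (hM₁ : ∀ u, |g u| ≤ M₁) (hρ : 0 < ρ) (x : ℝ) :
    Integrable (fun u => g (x - u)) ∧ ∫ u, |g (x - u)| ≤ 2 * ρ * M₁ := by
  have hM₁0 : 0 ≤ M₁ := (abs_nonneg _).trans (hM₁ 0)
  have hzero : ∀ u, u ∉ closedBall (x - a) ρ → g (x - u) = 0 := by
    intro u hu
    rw [mem_closedBall, Real.dist_eq, not_le] at hu
    exact hsupp (x - u) (by rw [show x - u - a = -(u - (x - a)) by ring, abs_neg]; exact hu)
  have hint : Integrable (fun u => g (x - u)) := by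
    have h1 : IntegrableOn (fun u => g (x - u)) (closedBall (x - a) ρ) :=
      (hg.comp (continuous_sub_left x)).continuousOn.integrableOn_compact (isCompact_closedBall _ _)
    have h2 : (fun u => g (x - u)) = (closedBall (x - a) ρ).indicator (fun u => g (x - u)) := by
      funext u
      by_cases hu : u ∈ closedBall (x - a) ρ
      · rw [indicator_of_mem hu]
      · rw [indicator_of_notMem hu, hzero u hu]
    rw [h2]
    exact h1.integrable_indicator measurableSet_closedBall
  refine ⟨hint, ?_⟩
  have h3 : ∫ u, |g (x - u)| = ∫ u in closedBall (x - a) ρ, |g (x - u)| := by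
    rw [← integral_indicator measurableSet_closedBall]
    refine integral_congr_ae (ae_of_all _ fun u => ?_)
    by_cases hu : u ∈ closedBall (x - a) ρ
    · rw [indicator_of_mem hu]
    · rw [indicator_of_notMem hu]
      simp only [hzero u hu, abs_zero]
  rw [h3]
  calc ∫ u in closedBall (x - a) ρ, |g (x - u)| ≤ ∫ u in closedBall (x - a) ρ, M₁ := by
        refine setIntegral_mono_on hint.norm.integrableOn (integrableOn_const measure_closedBall_lt_top.ne)
          measurableSet_closedBall (fun u _ => hM₁ _)
    _ = 2 * ρ * M₁ := by
        rw [setIntegral_const, smul_eq_mul, Real.volume_real_closedBall hρ.le]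

/-- **Scale-invariant decay of the truncated Hilbert integral of a localized mean-zero function.**
If `g` is continuous, supported in `[a-ρ, a+ρ]`, `|g| ≤ M₁`, `(M₂/ρ)`-Lipschitz and `∫ g = 0`,
then `|𝒯g(x)| ≤ 10(M₁+M₂)/(1 + ((x-a)/ρ)²)` for every `x`.
(Jin–Zhang arXiv:1710.00250, (e:hilbert-deriative-bound) and (e:bound-chi-tilde), made
quantitative.) [cite: JinZhang2017, §2.3] -/
theorem abs_hilbertPV_le_of_localized (hg : Continuous g)
    (hLip : ∀ u v, |g u - g v| ≤ M₂ / ρ * |u - v|) (hρ : 0 < ρ) (hM₂ : 0 ≤ M₂)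
    (hsupp : ∀ u, ρ < |u - a| → g u = 0) (hM₁ : ∀ u, |g u| ≤ M₁) (hmean : ∫ u, g u = 0) (x : ℝ) :
    |(∫ u in Ioo (-1 : ℝ) 1, (g (x - u) - g x) / u) + ∫ u in {u : ℝ | 1 ≤ |u|}, g (x - u) / u| ≤
      10 * (M₁ + M₂) / (1 + ((x - a) / ρ) ^ 2) := by
  have hM₁0 : 0 ≤ M₁ := (abs_nonneg _).trans (hM₁ 0)
  obtain ⟨hgint, hgabs⟩ := integral_abs_comp_sub_le hg hsupp hM₁ hρ x
  set d : ℝ := x - a with hd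
  -- (1) the uniform bound `2 M₂ + 2 M₁`, via the split at `r = ρ`
  have hunif : |(∫ u in Ioo (-1 : ℝ) 1, (g (x - u) - g x) / u) + ∫ u in {u : ℝ | 1 ≤ |u|}, g (x - u) / u|
      ≤ 2 * M₂ + 2 * M₁ := by
    rw [hilbertPV_split_eq hg hLip hρ hM₂ hsupp hM₁ hρ x]
    have hnear : |∫ u in Ioo (-ρ) ρ, (g (x - u) - g x) / u| ≤ 2 * M₂ := by
      have h1 := norm_setIntegral_le_of_norm_le_const (μ := volume) (f := fun u => (g (x - u) - g x) / u)
        (measure_Ioo_lt_top (a := -ρ) (b := ρ))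
        (fun u _ => (by rw [Real.norm_eq_abs]; exact abs_near_integrand_le hLip hρ hM₂ x u :
          ‖(g (x - u) - g x) / u‖ ≤ M₂ / ρ))
      rw [Real.norm_eq_abs, Real.volume_real_Ioo, max_eq_left (by linarith)] at h1
      calc _ ≤ M₂ / ρ * (ρ - -ρ) := h1
        _ = 2 * M₂ := by field_simp; ring
    have hfar : |∫ u in {u : ℝ | ρ ≤ |u|}, g (x - u) / u| ≤ 2 * M₁ := by
      have hF := integrableOn_far hg hsupp hM₁ hρ x
      calc |∫ u in {u : ℝ | ρ ≤ |u|}, g (x - u) / u| ≤ ∫ u in {u : ℝ | ρ ≤ |u|}, |g (x - u) / u| := by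
            simpa only [Real.norm_eq_abs] using norm_integral_le_integral_norm (fun u => g (x - u) / u)
        _ ≤ ∫ u in {u : ℝ | ρ ≤ |u|}, ρ⁻¹ * |g (x - u)| := by
            refine setIntegral_mono_on hF.norm (hgint.norm.const_mul _).integrableOn (measurableSet_le_abs ρ)
              (fun u hu => ?_)
            have hu : ρ ≤ |u| := hu
            rw [abs_div, div_eq_mul_inv, mul_comm]
            exact mul_le_mul_of_nonneg_right (inv_anti₀ hρ hu) (abs_nonneg _)
        _ ≤ ∫ u, ρ⁻¹ * |g (x - u)| :=
            setIntegral_le_integral (hgint.norm.const_mul _) (ae_of_all _ fun u => by positivity)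
        _ ≤ ρ⁻¹ * (2 * ρ * M₁) := by
            rw [integral_const_mul]; exact mul_le_mul_of_nonneg_left hgabs (by positivity)
        _ = 2 * M₁ := by field_simp
    calc _ ≤ |∫ u in Ioo (-ρ) ρ, (g (x - u) - g x) / u| + |∫ u in {u : ℝ | ρ ≤ |u|}, g (x - u) / u| :=
          abs_add_le _ _
      _ ≤ 2 * M₂ + 2 * M₁ := add_le_add hnear hfar
  -- (2) the far bound `4 M₁ ρ²/d²` for `|d| ≥ 2ρ`
  have hfarx : 2 * ρ ≤ |d| →
      |(∫ u in Ioo (-1 : ℝ) 1, (g (x - u) - g x) / u) + ∫ u in {u : ℝ | 1 ≤ |u|}, g (x - u) / u|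
        ≤ 4 * M₁ * ρ ^ 2 / d ^ 2 := by
    intro hdρ
    have hd0 : 0 < |d| := by linarith
    have hdne : d ≠ 0 := abs_pos.1 hd0
    have hgx : g x = 0 := hsupp x (by rw [← hd]; linarith)
    -- the integrand vanishes for `|u| < |d| - ρ`, in particular near `0`
    have hvan : ∀ u, |u| < |d| / 2 → g (x - u) = 0 := by
      intro u hu
      refine hsupp (x - u) ?_
      rw [show x - u - a = d - u by rw [hd]; ring]
      have := abs_sub_abs_le_abs_sub d u
      linarith
    -- hence both pieces are `∫ g(x-u)/u` and combine to the integral over `ℝ`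
    have hF : Integrable (fun u => g (x - u) / u) := by
      have h1 := integrableOn_far hg hsupp hM₁ (by positivity : 0 < |d| / 2) x
      have h2 : (fun u => g (x - u) / u) = {u : ℝ | |d| / 2 ≤ |u|}.indicator (fun u => g (x - u) / u) := by
        funext u
        by_cases hu : u ∈ {u : ℝ | |d| / 2 ≤ |u|}
        · rw [indicator_of_mem hu]
        · rw [indicator_of_notMem hu]
          simp only [mem_setOf_eq, not_le] at hu
          rw [hvan u hu, zero_div]
      rw [h2]
      exact h1.integrable_indicator (measurableSet_le_abs _)
    have hcomb : (∫ u in Ioo (-1 : ℝ) 1, (g (x - u) - g x) / u) + ∫ u in {u : ℝ | 1 ≤ |u|}, g (x - u) / u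
        = ∫ u, g (x - u) / u := by
      have h1 : ∫ u in Ioo (-1 : ℝ) 1, (g (x - u) - g x) / u = ∫ u in Ioo (-1 : ℝ) 1, g (x - u) / u := by
        refine integral_congr_ae (ae_of_all _ fun u => ?_)
        simp only [hgx, sub_zero]
      have h2 : (Ioo (-1 : ℝ) 1)ᶜ = {u : ℝ | 1 ≤ |u|} := by
        ext u
        simp only [mem_compl_iff, mem_Ioo, not_and_or, not_lt, mem_setOf_eq, le_abs, le_neg]
        tauto
      rw [h1, ← h2, integral_add_compl measurableSet_Ioo hF]
    -- subtract `d⁻¹ ∫ g = 0`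
    have hmean' : ∫ u, g (x - u) = 0 := by
      rw [integral_sub_left_eq_self g volume x]; exact hmean
    have hrepr : ∫ u, g (x - u) / u = ∫ u, g (x - u) * (u⁻¹ - d⁻¹) := by
      have h1 : ∫ u, g (x - u) * (u⁻¹ - d⁻¹) = (∫ u, g (x - u) / u) - ∫ u, g (x - u) * d⁻¹ := by
        rw [← integral_sub hF (hgint.mul_const _)]
        exact integral_congr_ae (ae_of_all _ fun u => by ring)
      rw [h1, integral_mul_const, hmean', zero_mul, sub_zero]
    rw [hcomb, hrepr]
    -- pointwise: `|g(x-u)| |1/u - 1/d| ≤ |g(x-u)| · 2ρ/d²`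
    have hpt : ∀ u, |g (x - u) * (u⁻¹ - d⁻¹)| ≤ 2 * ρ / d ^ 2 * |g (x - u)| := by
      intro u
      by_cases hu : |u| < |d| / 2
      · rw [hvan u hu]; simp
      · push Not at hu
        have hu0 : u ≠ 0 := by intro h0; rw [h0, abs_zero] at hu; linarith
        by_cases hsup : ρ < |x - u - a|
        · rw [hsupp _ hsup]; simp
        · push Not at hsup
          rw [show x - u - a = d - u by rw [hd]; ring] at hsup
          rw [abs_mul, mul_comm]
          refine mul_le_mul_of_nonneg_right ?_ (abs_nonneg _)
          rw [inv_sub_inv hu0 hdne, abs_div, abs_mul, div_le_div_iff₀ (by positivity) (by positivity)]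
          have h1 : |d - u| * d ^ 2 ≤ ρ * d ^ 2 := mul_le_mul_of_nonneg_right hsup (sq_nonneg _)
          have h2 : ρ * d ^ 2 ≤ 2 * ρ * (|u| * |d|) := by
            have : d ^ 2 = |d| * |d| := by rw [← sq_abs]; ring
            have h5 : |d| ≤ 2 * |u| := by linarith
            rw [this]
            calc ρ * (|d| * |d|) = (ρ * |d|) * |d| := by ring
              _ ≤ (ρ * |d|) * (2 * |u|) := mul_le_mul_of_nonneg_left h5 (by positivity)
              _ = 2 * ρ * (|u| * |d|) := by ring
          linarith
    calc |∫ u, g (x - u) * (u⁻¹ - d⁻¹)| ≤ ∫ u, |g (x - u) * (u⁻¹ - d⁻¹)| := by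
          simpa only [Real.norm_eq_abs] using norm_integral_le_integral_norm (fun u => g (x - u) * (u⁻¹ - d⁻¹))
      _ ≤ ∫ u, 2 * ρ / d ^ 2 * |g (x - u)| := by
          refine integral_mono_of_nonneg (ae_of_all _ fun u => abs_nonneg _) (hgint.norm.const_mul _)
            (ae_of_all _ hpt)
      _ ≤ 2 * ρ / d ^ 2 * (2 * ρ * M₁) := by
          rw [integral_const_mul]; exact mul_le_mul_of_nonneg_left hgabs (by positivity)
      _ = 4 * M₁ * ρ ^ 2 / d ^ 2 := by field_simp; ring
  -- (3) combine
  have hden : 0 < 1 + (d / ρ) ^ 2 := by positivity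
  rw [le_div_iff₀ hden]
  rcases lt_or_ge |d| (2 * ρ) with hlt | hge
  · -- near: `1 + (d/ρ)² < 5`
    have hρ2 : 0 < ρ ^ 2 := by positivity
    have h1 : (d / ρ) ^ 2 < 4 := by
      rw [div_pow, div_lt_iff₀ hρ2]
      have : d ^ 2 = |d| ^ 2 := (sq_abs d).symm
      rw [this]; nlinarith [abs_nonneg d]
    nlinarith [hunif, abs_nonneg ((∫ u in Ioo (-1 : ℝ) 1, (g (x - u) - g x) / u) +
      ∫ u in {u : ℝ | 1 ≤ |u|}, g (x - u) / u)]
  · -- far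
    have h2 := hfarx hge
    have hd0 : 0 < |d| := by linarith
    have hdne : d ≠ 0 := abs_pos.1 hd0
    have hdsq : 0 < d ^ 2 := by positivity
    have hρ2 : 0 < ρ ^ 2 := by positivity
    have h3 : 4 ≤ (d / ρ) ^ 2 := by
      rw [div_pow, le_div_iff₀ hρ2]
      have : d ^ 2 = |d| ^ 2 := (sq_abs d).symm
      rw [this]; nlinarith [abs_nonneg d]
    set T := |(∫ u in Ioo (-1 : ℝ) 1, (g (x - u) - g x) / u) + ∫ u in {u : ℝ | 1 ≤ |u|}, g (x - u) / u|
    have hT0 : 0 ≤ T := abs_nonneg _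
    -- `T (1 + (d/ρ)²) ≤ (4 M₁ ρ²/d²)(1 + d²/ρ²) = 4M₁ (ρ²/d² + 1) ≤ 4 M₁ (1/4 + 1)`
    have h4 : T * (1 + (d / ρ) ^ 2) ≤ 4 * M₁ * ρ ^ 2 / d ^ 2 * (1 + (d / ρ) ^ 2) :=
      mul_le_mul_of_nonneg_right h2 hden.le
    have h5 : 4 * M₁ * ρ ^ 2 / d ^ 2 * (1 + (d / ρ) ^ 2) = 4 * M₁ * (ρ ^ 2 / d ^ 2 + 1) := by
      field_simp
    have h6 : ρ ^ 2 / d ^ 2 ≤ 1 / 4 := by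
      rw [div_le_div_iff₀ hdsq (by norm_num)]
      have : d ^ 2 = |d| ^ 2 := (sq_abs d).symm
      rw [this]; nlinarith [abs_nonneg d]
    nlinarith

end Decay

/-! ### Additivity and separated sums -/

section Sums

/-- **Additivity of the truncated Hilbert integral** over finite sums of continuous, Lipschitz,
boundedly supported functions. [folklore] -/
theorem hilbertPV_finset_sum {ι : Type*} (s : Finset ι) (g : ι → ℝ → ℝ)
    (hg : ∀ i ∈ s, Continuous (g i))
    (hLip : ∀ i ∈ s, ∃ K : ℝ, 0 ≤ K ∧ ∀ u v, |g i u - g i v| ≤ K * |u - v|)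
    (hbd : ∀ i ∈ s, ∃ S M : ℝ, (∀ u, S < |u| → g i u = 0) ∧ ∀ u, |g i u| ≤ M) (x : ℝ) :
    (∫ u in Ioo (-1 : ℝ) 1, ((∑ i ∈ s, g i (x - u)) - ∑ i ∈ s, g i x) / u) +
        ∫ u in {u : ℝ | 1 ≤ |u|}, (∑ i ∈ s, g i (x - u)) / u =
      ∑ i ∈ s, ((∫ u in Ioo (-1 : ℝ) 1, (g i (x - u) - g i x) / u) +
        ∫ u in {u : ℝ | 1 ≤ |u|}, g i (x - u) / u) := by
  -- integrability of every summand
  have hnear : ∀ i ∈ s, IntegrableOn (fun u => (g i (x - u) - g i x) / u) (Ioo (-1 : ℝ) 1) := by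
    intro i hi
    obtain ⟨K, hK0, hK⟩ := hLip i hi
    refine integrableOn_near_Ioo (M₂ := K) (ρ := 1) (hg i hi) (fun u v => ?_) one_pos hK0 x 1
    simpa using hK u v
  have hfar : ∀ i ∈ s, IntegrableOn (fun u => g i (x - u) / u) {u : ℝ | 1 ≤ |u|} := by
    intro i hi
    obtain ⟨S, M, hS, hM⟩ := hbd i hi
    refine integrableOn_far (a := 0) (ρ := S) (hg i hi) (fun u hu => hS u (by simpa using hu)) hM one_pos x
  have h1 : ∫ u in Ioo (-1 : ℝ) 1, ((∑ i ∈ s, g i (x - u)) - ∑ i ∈ s, g i x) / u =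
      ∑ i ∈ s, ∫ u in Ioo (-1 : ℝ) 1, (g i (x - u) - g i x) / u := by
    rw [← integral_finsetSum s hnear]
    refine integral_congr_ae (ae_of_all _ fun u => ?_)
    simp only
    rw [← Finset.sum_sub_distrib, Finset.sum_div]
  have h2 : ∫ u in {u : ℝ | 1 ≤ |u|}, (∑ i ∈ s, g i (x - u)) / u =
      ∑ i ∈ s, ∫ u in {u : ℝ | 1 ≤ |u|}, g i (x - u) / u := by
    rw [← integral_finsetSum s hfar]
    refine integral_congr_ae (ae_of_all _ fun u => ?_)
    simp only
    rw [Finset.sum_div]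
  rw [h1, h2, ← Finset.sum_add_distrib]

/-- **Sums over `1`-separated points**: `∑ᵢ 1/(1 + pᵢ²) ≤ 2π` whenever `|pᵢ - pⱼ| ≥ 1` for
`i ≠ j` (compare with `2 ∫ du/(1+u²)` over the disjoint intervals `(pᵢ - 1/2, pᵢ + 1/2]`).
(Jin–Zhang arXiv:1710.00250, (e:bound-mnclose).) [folklore] -/
theorem sum_inv_one_add_sq_le_of_separated {ι : Type*} (s : Finset ι) (p : ι → ℝ)
    (hsep : ∀ i ∈ s, ∀ j ∈ s, i ≠ j → 1 ≤ |p i - p j|) :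
    ∑ i ∈ s, 1 / (1 + (p i) ^ 2) ≤ 2 * π := by
  classical
  set I : ι → Set ℝ := fun i => Ioc (p i - 1 / 2) (p i + 1 / 2) with hI
  have hIm : ∀ i, MeasurableSet (I i) := fun i => measurableSet_Ioc
  have hint : Integrable fun u : ℝ => (1 + u ^ 2)⁻¹ := integrable_inv_one_add_sq
  -- each term is at most twice the integral over its interval
  have hterm : ∀ i, 1 / (1 + (p i) ^ 2) ≤ 2 * ∫ u in I i, (1 + u ^ 2)⁻¹ := by
    intro i
    have hlow : ∫ u in I i, (2 * (1 + (p i) ^ 2))⁻¹ ≤ ∫ u in I i, (1 + u ^ 2)⁻¹ := by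
      refine setIntegral_mono_on (integrableOn_const measure_Ioc_lt_top.ne) hint.integrableOn (hIm i)
        (fun u hu => ?_)
      rw [hI] at hu
      simp only [mem_Ioc] at hu
      refine inv_anti₀ (by positivity) ?_
      set e : ℝ := u - p i with he_def
      have he : |e| ≤ 1 / 2 := abs_le.2 ⟨by linarith, by linarith⟩
      have hu' : u = p i + e := by rw [he_def]; ring
      have h3 : 2 * (p i) * e ≤ |p i| := by
        have h4 : |p i * e| ≤ |p i| * (1 / 2) := by
          rw [abs_mul]; exact mul_le_mul_of_nonneg_left he (abs_nonneg _)
        have h5 : p i * e ≤ |p i * e| := le_abs_self _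
        linarith
      have h6 : e ^ 2 ≤ 1 / 4 := by
        have h7 : e ^ 2 = |e| ^ 2 := (sq_abs e).symm
        rw [h7]; nlinarith [abs_nonneg e]
      have h8 : |p i| ≤ (p i) ^ 2 + 1 / 4 := by nlinarith [sq_nonneg (|p i| - 1 / 2), sq_abs (p i)]
      rw [hu']
      nlinarith
    rw [setIntegral_const, smul_eq_mul, hI] at hlow
    simp only at hlow
    rw [Real.volume_real_Ioc, max_eq_left (by linarith)] at hlow
    have : (p i + 1 / 2 - (p i - 1 / 2)) * (2 * (1 + p i ^ 2))⁻¹ = (1 / (1 + p i ^ 2)) / 2 := by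
      field_simp; ring
    rw [this] at hlow
    linarith
  -- the intervals are pairwise disjoint
  have hdisj : Set.PairwiseDisjoint (↑s : Set ι) I := by
    intro i hi j hj hij
    rw [Function.onFun, hI, Set.disjoint_left]
    intro u hui huj
    simp only [mem_Ioc] at hui huj
    have := hsep i hi j hj hij
    have h1 : |p i - p j| < 1 := abs_lt.2 ⟨by linarith, by linarith⟩
    linarith
  calc ∑ i ∈ s, 1 / (1 + (p i) ^ 2) ≤ ∑ i ∈ s, 2 * ∫ u in I i, (1 + u ^ 2)⁻¹ :=
        Finset.sum_le_sum fun i _ => hterm i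
    _ = 2 * ∫ u in ⋃ i ∈ s, I i, (1 + u ^ 2)⁻¹ := by
        rw [← Finset.mul_sum, integral_biUnion_finset s (fun i _ => hIm i) hdisj
          (fun i _ => hint.integrableOn)]
    _ ≤ 2 * ∫ u, (1 + u ^ 2)⁻¹ :=
        mul_le_mul_of_nonneg_left (setIntegral_le_integral hint (ae_of_all _ fun u => by positivity))
          (by norm_num)
    _ = 2 * π := by rw [integral_univ_inv_one_add_sq]

end Sums

end Literature.Analysis.Fourier
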